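import Mathlib.RingTheory.MvPolynomial.Homogeneous
import Mathlib.RingTheory.LocalRing.ResidueField.Basic
import HarnessLib

/-!
# [OURS · L1 W4.5(b) · EL♮(3) · T23-A⁗ (L2)] LIFTING A LINEAR FORM THROUGH A SECTION — the algebra of «`ℓ̃` lifts `ℓ` and vanishes on the `O`-point `a`»

res-L1-w45b-stub-2 g13 (OFFER 2026-08-28T12:16:47Z for the A⁗ DEAL; engine word res-L1-w45b-stub-4 `T23A4-ENGINE-WORD-v2.md` 81913c484db62a21 §1/§3 (L2),
fork (α) «lift `ℓ̃` THROUGH THE GIVEN section»). Crux EL♮(3) = stmt-ResolutionOfSingularities-20148 (parent EL♮ stmt-…-20038; node stmt-…-15660), route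
`EquisingularLift`, line `sections`. OURS; NOT a statement of any manuscript; AI-written, weaker than expert review. DEF-FREE; no `sorry`; standard axioms; pure
Mathlib algebra. `--supports stmt-ResolutionOfSingularities-20148 --as helper`.

WHAT. Over a ring `O` with a surjection `θ : O →+* k` and a point `a : ι → O` having a UNIT coordinate `a i₀`, a `k`-linear relation `∑ c̄ⱼ θ(aⱼ) = 0` lifts to an
`O`-linear relation `∑ cⱼ aⱼ = 0` with `θ cⱼ = c̄ⱼ` (`exists_lift_sum_mul_eq_zero`: lift arbitrarily, then correct the `i₀`-coefficient by `(∑ c₀ⱼ aⱼ)·(a i₀)⁻¹ ∈ ker θ`).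
Dressed for the A⁗ letters: a homogeneous LINEAR form `ℓ ∈ k[x₀,…,xₙ]` vanishing at the reduction `θ ∘ a` of an `O`-point `a` with a unit coordinate lifts to a
homogeneous linear form `ℓ̃ ∈ O[x₀,…,xₙ]` with `map θ ℓ̃ = ℓ` and `eval a ℓ̃ = 0` (`exists_isHomogeneous_one_lift_eval_eq_zero`); if `θ` is local (units lift) and
`ℓ ≠ 0`, some coefficient of `ℓ̃` is a unit (`exists_isUnit_coeff_of_map_ne_zero`) — the «ONE unit coefficient» res-type-027's (H1) `LinearCentre` reuse wants.
[cite: AtiyahMacdonald1969, Prop. 1.9 and Ch. 1 Ex. 1] (units of a local ring; method, index only).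
-/

set_option linter.dupNamespace false -- mandated namespace `Summit.<Summit>.<Problem>` of this single-conjunct summit

noncomputable section

open MvPolynomial Finset

namespace Summit.ResolutionOfSingularities.ResolutionOfSingularities.Cruxes.EquisingularLiftNat.Sections.LetterLift

variable {O k : Type*} [CommRing O] [CommRing k] (θ : O →+* k)

/-- **Lifting a linear relation through a surjection, vanishing at a point with a unit coordinate.** [OURS · elementary] -/
theorem exists_lift_sum_mul_eq_zero (hθ : Function.Surjective θ) {ι : Type*} [Fintype ι] [DecidableEq ι]
    (a : ι → O) (i₀ : ι) (hi₀ : IsUnit (a i₀)) (cbar : ι → k) (h : ∑ j, cbar j * θ (a j) = 0) :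
    ∃ c : ι → O, (∀ j, θ (c j) = cbar j) ∧ ∑ j, c j * a j = 0 := by
  classical
  choose c₀ hc₀ using fun j => hθ (cbar j)
  obtain ⟨u, hu⟩ := hi₀
  set r : O := ∑ j, c₀ j * a j with hr
  have hθr : θ r = 0 := by
    rw [hr, map_sum]
    simp only [map_mul, hc₀]
    exact h
  refine ⟨fun j => if j = i₀ then c₀ i₀ - r * ↑u⁻¹ else c₀ j, fun j => ?_, ?_⟩
  · by_cases hj : j = i₀
    · subst hj
      simp only [if_true, map_sub, map_mul, hθr, zero_mul, sub_zero, hc₀]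
    · simp only [hj, if_false, hc₀]
  · have hsplit : ∑ j, (if j = i₀ then c₀ i₀ - r * ↑u⁻¹ else c₀ j) * a j =
        ∑ j, c₀ j * a j - r * ↑u⁻¹ * a i₀ := by
      have h1 : ∀ j, (if j = i₀ then c₀ i₀ - r * ↑u⁻¹ else c₀ j) * a j =
          c₀ j * a j - (if j = i₀ then r * ↑u⁻¹ * a i₀ else 0) := by
        intro j
        by_cases hj : j = i₀
        · subst hj; simp only [if_true]; ring
        · simp only [hj, if_false, sub_zero]
      simp only [h1, Finset.sum_sub_distrib, Finset.sum_ite_eq', Finset.mem_univ, if_true]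
    rw [hsplit, ← hr, ← hu, mul_assoc, Units.inv_mul, mul_one, sub_self]

/-- A homogeneous polynomial of degree `1` is the linear form of its degree-one coefficients: `ℓ = ∑ⱼ coeff (single j 1) ℓ • X j`. [OURS · elementary] -/
theorem eq_sum_coeff_single_mul_X_of_isHomogeneous_one {R : Type*} [CommRing R] {ι : Type*} [Fintype ι] [DecidableEq ι]
    (ℓ : MvPolynomial ι R) (hℓ : ℓ.IsHomogeneous 1) :
    ℓ = ∑ j, C (coeff (Finsupp.single j 1) ℓ) * X j := by
  classical
  ext d
  rw [coeff_sum]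
  simp only [coeff_C_mul, coeff_X]
  by_cases hd : ∃ j, Finsupp.single j 1 = d
  · obtain ⟨j, rfl⟩ := hd
    rw [Finset.sum_eq_single j]
    · simp
    · intro b _ hb
      rw [if_neg]
      · simp
      · intro h
        exact hb (Finsupp.single_left_injective one_ne_zero h)
    · intro h; exact absurd (Finset.mem_univ j) h
  · -- `d` is not a degree-one monomial: both sides vanish
    have hzero : coeff d ℓ = 0 := by
      by_contra hne
      have hdeg : d.degree = 1 := by
        have h1 : Finsupp.weight (1 : ι → ℕ) d = 1 := hℓ hne
        rw [Finsupp.degree_eq_weight_one]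
        exact h1
      have hmem : d ∈ Set.range (fun a : ι => Finsupp.single a 1) := by
        rw [Finsupp.range_single_one]; exact hdeg
      obtain ⟨j, hj⟩ := hmem
      exact hd ⟨j, hj⟩
    rw [hzero, eq_comm]
    refine Finset.sum_eq_zero fun j _ => ?_
    rw [if_neg (fun h => hd ⟨j, h⟩), mul_zero]

/-- **Lifting a LINEAR FORM through a section**: `ℓ ∈ k[x]` homogeneous of degree `1` with `ℓ(θ ∘ a) = 0` for an `O`-point `a` with a unit coordinate lifts
to a homogeneous linear form `ℓ̃ ∈ O[x]` with `map θ ℓ̃ = ℓ` and `ℓ̃(a) = 0`. [OURS · elementary; A⁗ (L2) fork (α)] -/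
theorem exists_isHomogeneous_one_lift_eval_eq_zero (hθ : Function.Surjective θ) {ι : Type*} [Fintype ι] [DecidableEq ι]
    (a : ι → O) (i₀ : ι) (hi₀ : IsUnit (a i₀)) (ℓ : MvPolynomial ι k) (hℓ : ℓ.IsHomogeneous 1)
    (hℓa : eval (fun j => θ (a j)) ℓ = 0) :
    ∃ ℓt : MvPolynomial ι O, ℓt.IsHomogeneous 1 ∧ MvPolynomial.map θ ℓt = ℓ ∧ eval a ℓt = 0 := by
  classical
  have hrel : ∑ j, coeff (Finsupp.single j 1) ℓ * θ (a j) = 0 := by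
    have h := hℓa
    rw [eq_sum_coeff_single_mul_X_of_isHomogeneous_one ℓ hℓ, map_sum] at h
    simpa only [map_mul, eval_C, eval_X] using h
  obtain ⟨c, hc, hca⟩ := exists_lift_sum_mul_eq_zero θ hθ a i₀ hi₀ (fun j => coeff (Finsupp.single j 1) ℓ) hrel
  refine ⟨∑ j, C (c j) * X j, ?_, ?_, ?_⟩
  · exact IsHomogeneous.sum _ _ _ fun j _ => by
      simpa using (isHomogeneous_C _ (c j)).mul (isHomogeneous_X O j)
  · rw [map_sum]
    simp only [map_mul, map_C, map_X, hc]
    exact (eq_sum_coeff_single_mul_X_of_isHomogeneous_one ℓ hℓ).symm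
  · rw [map_sum]
    simpa only [map_mul, eval_C, eval_X] using hca

/-- If `θ` reflects units (e.g. the residue map of a local ring) and the reduction `map θ ℓt` is non-zero, some coefficient of `ℓt` is a UNIT.
[OURS · elementary] -/
theorem exists_isUnit_coeff_of_map_ne_zero [IsLocalHom θ] {ι : Type*} (hk : ∀ x : k, x ≠ 0 → IsUnit x)
    (ℓt : MvPolynomial ι O) (h : MvPolynomial.map θ ℓt ≠ 0) : ∃ d, IsUnit (coeff d ℓt) := by
  obtain ⟨d, hd⟩ := MvPolynomial.ne_zero_iff.mp h
  rw [coeff_map] at hd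
  exact ⟨d, isUnit_of_map_unit θ _ (hk _ hd)⟩

end Summit.ResolutionOfSingularities.ResolutionOfSingularities.Cruxes.EquisingularLiftNat.Sections.LetterLift

end
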